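import Mathlib
import Literature.NumberTheory.GaloisRepresentations.ResidualPair
import Literature.NumberTheory.GaloisRepresentations.ResidualPairIntegrality
import Literature.NumberTheory.GaloisRepresentations.CompactImageCharpolyIntegral
import Literature.NumberTheory.GaloisRepresentations.FrobeniusDensity
import Literature.NumberTheory.GaloisRepresentations.WeilDeligneRepMonodromyProofs
import Literature.NumberTheory.Automorphic.ChebotarevArtinRepHolds
import HarnessLib

/-!
# Route `PhantomRMYoshida`, crux `StableYoshidaCongruence` (stmt-Langlands-13640), line
# `level-three-weierstrass-switch`: Stub 1a `stub_charpolyCongruence`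

Two continuous `r, r' : Γ_ℚ → GL₄(ℚ̄_p)` with the SAME residual pair `(σ, σ')` through a ring map
`red : 𝒪 = 𝒪_{ℚ̄_p} → k` to a field of characteristic `p`
(`FramedGaloisRep.HasResidualPair`, `Literature/NumberTheory/GaloisRepresentations/ResidualPair.lean`:
at almost all places `v` the Frobenius polynomial is `p`-integral and reduces under `red` to
`charpoly σ(Frob_v) · charpoly σ'(Frob_v)`) have congruent characteristic polynomials EVERYWHERE:
for every `τ ∈ Γ_ℚ` the polynomials `det(X - r(τ))`, `det(X - r'(τ))` have coefficients in `𝒪`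
(compact image) and the same image under `red`.  This is the GLOBAL half of the transfer of residual
`p`-distinguishedness in the checked skeleton of the line (registered signature, verbatim).

Proof (Serre, *Abelian ℓ-adic representations*, Ch. I §2.2 Cor. 2 (a), §2.3; Deligne–Serre 1974 §6):

1. `red` kills exactly the maximal ideal `{‖x‖ < 1}` of the rank-one valuation ring `𝒪`
   (`‖x‖ < 1 ⇒ ‖x‖^N < ‖p‖ ⇒ x^N ∈ p𝒪 ⇒ red(x)^N = 0`; `‖x‖ = 1 ⇒ x ∈ 𝒪ˣ ⇒ red x ≠ 0`), so for
   integral `P, P'` the congruence `P.map red = P'.map red` says `‖P_i - P'_i‖ < 1` for all `i`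
   (`map_red_eq_iff_forall_norm_sub_lt_one`).
2. The set `T = {τ | ∀ i, ‖coeff_i charpoly r(τ) - coeff_i charpoly r'(τ)‖ < 1}` is CLOSED:
   `τ ↦ r(τ)` is continuous, the coefficients of `Matrix.charpoly` are polynomial in the entries
   (tree `Monodromy.continuous_charpoly_coeff`, Mathlib `Matrix.charpoly.univ`), and the open unit
   ball of the ultrametric `ℚ̄_p` is closed (Mathlib `IsUltrametricDist.isClosed_ball`).
3. `T` contains every arithmetic Frobenius at every prime above every place outside the finite
   exceptional set of the two `HasResidualPair` hypotheses: there `charpoly r(Frob) = P`,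
   `charpoly r'(Frob) = P'` with `P̄ = P₁P₂ = P̄'`, the `Pᵢ` being THE Frobenius polynomials of
   `σ, σ'` (`FramedGaloisRep.HasFrobCharpolyAt.unique`).
4. Those Frobenii are dense (`absoluteGaloisGroup.frobenius_dense`, from Chebotarev
   `chebotarev_artinRep_holds`), so `T = Γ_ℚ`; integrality of `charpoly r(τ)` for every `τ` is
   `FramedGaloisRep.exists_charpoly_eq_map` (compact `Γ_ℚ`).

Everything used is proved in the tree; no named fact is taken as a hypothesis.
-/

-- `Summit.Langlands.Langlands.…` (summit = sub-problem name, D-0017 layout) trips `dupNamespace` on every decl.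
set_option linter.dupNamespace false

noncomputable section

open Literature.NumberTheory.GaloisRepresentations Literature.NumberTheory.Automorphic
open IsDedekindDomain Filter
open scoped NumberField

namespace Summit.Langlands.Langlands.Cruxes.StableYoshidaCongruence.LevelThreeWeierstrassSwitch

section Red

variable {p : ℕ} [Fact p.Prime] {k : Type} [Field k] [CharP k p]

/-- Every ring map `red : 𝒪_{ℚ̄_p} → k` to a field of characteristic `p` kills the maximal ideal
`{‖x‖ < 1}`: `‖x‖^N < ‖p‖` for some `N`, so `x^N ∈ p𝒪` and `red(x)^N = red(p)·_ = 0`. [folklore] -/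
theorem red_eq_zero_of_norm_lt_one (red : Valued.integer (PadicAlgCl p) →+* k)
    (x : Valued.integer (PadicAlgCl p)) (hx : ‖(x : PadicAlgCl p)‖ < 1) : red x = 0 := by
  -- adapted from `Cruxes/ResiduallyYoshidaLifting/Disproof.lean` (T10, `red_eq_zero_of_norm_lt_one`)
  have hp0 : 0 < ‖((p : ℕ) : PadicAlgCl p)‖ :=
    norm_pos_iff.2 (Nat.cast_ne_zero.2 (Fact.out : p.Prime).ne_zero)
  obtain ⟨N, hN⟩ := exists_pow_lt_of_lt_one hp0 hx
  have hz : ‖(x : PadicAlgCl p) ^ N / (p : PadicAlgCl p)‖ ≤ 1 := by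
    rw [norm_div, norm_pow]
    exact (div_le_one hp0).2 hN.le
  let z : Valued.integer (PadicAlgCl p) := ⟨_, PadicAlgCl.mem_integer_of_norm_le_one hz⟩
  have hxN : x ^ N = (p : Valued.integer (PadicAlgCl p)) * z := by
    apply Subtype.ext
    change ((x ^ N : Valued.integer (PadicAlgCl p)) : PadicAlgCl p) =
      ((p : Valued.integer (PadicAlgCl p)) : PadicAlgCl p) *
        ((x : PadicAlgCl p) ^ N / (p : PadicAlgCl p))
    have hp0' : (p : PadicAlgCl p) ≠ 0 := norm_pos_iff.1 hp0
    push_cast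
    field_simp
  have h0 : red x ^ N = 0 := by
    rw [← map_pow, hxN, map_mul, map_natCast, CharP.cast_eq_zero, zero_mul]
  exact eq_zero_of_pow_eq_zero h0

omit [CharP k p] in
/-- Conversely `red x = 0` forces `‖x‖ < 1`: an integer of norm `1` is a unit of the valuation ring
`𝒪_{ℚ̄_p}` (its inverse has norm `1`), and `red` sends units to units of the field `k`. [folklore] -/
theorem norm_lt_one_of_red_eq_zero (red : Valued.integer (PadicAlgCl p) →+* k)
    {x : Valued.integer (PadicAlgCl p)} (hx : red x = 0) : ‖(x : PadicAlgCl p)‖ < 1 := by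
  have hle : ‖(x : PadicAlgCl p)‖ ≤ 1 := by
    have h : Valued.v (x : PadicAlgCl p) ≤ 1 := x.2
    rw [PadicAlgCl.valuation_def] at h
    exact_mod_cast h
  refine lt_of_le_of_ne hle fun h1 => ?_
  have hx0 : (x : PadicAlgCl p) ≠ 0 := fun h0 => by
    rw [h0, norm_zero] at h1
    exact zero_ne_one h1
  have hinv : ‖(x : PadicAlgCl p)⁻¹‖ ≤ 1 := by rw [norm_inv, h1, inv_one]
  let y : Valued.integer (PadicAlgCl p) := ⟨_, PadicAlgCl.mem_integer_of_norm_le_one hinv⟩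
  have hxy : x * y = 1 := Subtype.ext (mul_inv_cancel₀ hx0)
  have h := congrArg red hxy
  rw [map_mul, hx, zero_mul, map_one] at h
  exact zero_ne_one h

/-- For integral polynomials `P, P' ∈ 𝒪_{ℚ̄_p}[X]`: `red P = red P'` iff all coefficient
differences lie in the maximal ideal `{‖x‖ < 1}` (`ker red = 𝔪`). [folklore] -/
theorem map_red_eq_iff_forall_norm_sub_lt_one (red : Valued.integer (PadicAlgCl p) →+* k)
    (P P' : Polynomial (Valued.integer (PadicAlgCl p))) :
    P.map red = P'.map red ↔
      ∀ i, ‖((P.coeff i : Valued.integer (PadicAlgCl p)) : PadicAlgCl p) - P'.coeff i‖ < 1 := by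
  constructor
  · intro h i
    have hi := congrArg (fun Q => Polynomial.coeff Q i) h
    simp only [Polynomial.coeff_map] at hi
    have hlt := norm_lt_one_of_red_eq_zero red (x := P.coeff i - P'.coeff i)
      (by rw [map_sub, hi, sub_self])
    simpa using hlt
  · intro h
    ext i
    simp only [Polynomial.coeff_map]
    have h0 := red_eq_zero_of_norm_lt_one red (P.coeff i - P'.coeff i) (by simpa using h i)
    rwa [map_sub, sub_eq_zero] at h0

end Red

/-- **Stub 1a (`stub_charpolyCongruence`).**  Two continuous `r, r' : Γ_ℚ → GL₄(ℚ̄_p)` with the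
SAME residual pair `(σ, σ')` through `red` (tree `FramedGaloisRep.HasResidualPair`: at almost all
`v` the Frobenius polynomial is `p`-integral and reduces to `charpoly σ(Frob_v) · charpoly σ'(Frob_v)`)
have congruent characteristic polynomials EVERYWHERE: for every `τ ∈ Γ_ℚ`, `charpoly r(τ)` and
`charpoly r'(τ)` have coefficients in `𝒪 = 𝒪_{ℚ̄_p}` (compact image) and the same image under `red`.
Proof: the congruence locus `T ⊆ Γ_ℚ` is closed (continuity of `τ ↦ r(τ)`, polynomiality of the
coefficients of `charpoly`, the unit ball of the ultrametric `ℚ̄_p` is clopen, `ker red = 𝔪`),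
contains the arithmetic Frobenii at all primes above all places outside a finite set (the two
`HasResidualPair` clauses and uniqueness of Frobenius polynomials of `σ, σ'`), and these are dense
(Chebotarev: `absoluteGaloisGroup.frobenius_dense chebotarev_artinRep_holds`), so `T = Γ_ℚ`.
[cite: SerreAbelianLadic1968, Ch. I §2.2 Cor. 2 (a), §2.3] -/
theorem stub_charpolyCongruence :
    ∀ (p : ℕ) [Fact p.Prime] (k : Type) [Field k] [CharP k p] [TopologicalSpace k]
      (red : Valued.integer (PadicAlgCl p) →+* k)
      (σ σ' : FramedGaloisRep ℚ k 2) (r r' : FramedGaloisRep ℚ (PadicAlgCl p) 4),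
      r.HasResidualPair red σ σ' → r'.HasResidualPair red σ σ' →
      ∀ τ : Field.absoluteGaloisGroup ℚ,
        ∃ P P' : Polynomial (Valued.integer (PadicAlgCl p)),
          P.map (Valued.integer (PadicAlgCl p)).subtype = FramedRep.charpoly r τ ∧
          P'.map (Valued.integer (PadicAlgCl p)).subtype = FramedRep.charpoly r' τ ∧
          P.map red = P'.map red := by
  intro p _ k _ _ _ red σ σ' r r' hr hr' τ
  -- (2) the congruence locus `T` and its closedness
  set T : Set (Field.absoluteGaloisGroup ℚ) :=
    {τ | ∀ i : ℕ, ‖(FramedRep.charpoly r τ).coeff i - (FramedRep.charpoly r' τ).coeff i‖ < 1}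
    with hT_def
  have hcoeff : ∀ (ρ : FramedGaloisRep ℚ (PadicAlgCl p) 4) (i : ℕ),
      Continuous fun τ => (FramedRep.charpoly ρ τ).coeff i := fun ρ i =>
    (Monodromy.continuous_charpoly_coeff i).comp (Units.continuous_val.comp (map_continuous ρ))
  have hTc : IsClosed T := by
    have hT : T = ⋂ i : ℕ, (fun τ => (FramedRep.charpoly r τ).coeff i -
        (FramedRep.charpoly r' τ).coeff i) ⁻¹' Metric.ball (0 : PadicAlgCl p) 1 := by
      ext τ
      simp only [hT_def, Set.mem_setOf_eq, Set.mem_iInter, Set.mem_preimage, mem_ball_zero_iff]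
    rw [hT]
    exact isClosed_iInter fun i =>
      (IsUltrametricDist.isClosed_ball _ _).preimage ((hcoeff r i).sub (hcoeff r' i))
  -- (3)+(4) `T` contains the dense set of good Frobenii
  have h12 := Filter.eventually_cofinite.mp
    ((FramedGaloisRep.hasResidualPair_iff.mp hr).and (FramedGaloisRep.hasResidualPair_iff.mp hr'))
  have hdense : Dense T := by
    refine (absoluteGaloisGroup.frobenius_dense chebotarev_artinRep_holds ℚ _ h12).mono ?_
    rintro φ ⟨v, hv, 𝔓, h𝔓, hφ⟩
    simp only [Set.mem_setOf_eq, not_not] at hv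
    obtain ⟨⟨-, -, -, P, P₁, P₂, hP, hP₁, hP₂, hred⟩, -, -, -, P', P₁', P₂', hP', hP₁', hP₂', hred'⟩ :=
      hv
    have hPP' : P.map red = P'.map red := by
      rw [hred, hred', hP₁.unique hP₁', hP₂.unique hP₂']
    simp only [hT_def, Set.mem_setOf_eq]
    intro i
    have h := (map_red_eq_iff_forall_norm_sub_lt_one red P P').1 hPP' i
    rw [hP 𝔓 h𝔓 φ hφ, hP' 𝔓 h𝔓 φ hφ, Polynomial.coeff_map, Polynomial.coeff_map]
    exact h
  have hTuniv : T = Set.univ := hTc.closure_eq.symm.trans hdense.closure_eq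
  have hτ : τ ∈ T := hTuniv ▸ Set.mem_univ τ
  -- integrality at `τ` and conclusion via (1)
  obtain ⟨P, hP⟩ := FramedGaloisRep.exists_charpoly_eq_map r τ
  obtain ⟨P', hP'⟩ := FramedGaloisRep.exists_charpoly_eq_map r' τ
  refine ⟨P, P', hP, hP', (map_red_eq_iff_forall_norm_sub_lt_one red P P').2 fun i => ?_⟩
  have h := hτ i
  rw [← hP, ← hP', Polynomial.coeff_map, Polynomial.coeff_map] at h
  exact h

end Summit.Langlands.Langlands.Cruxes.StableYoshidaCongruence.LevelThreeWeierstrassSwitch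

end
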